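import Literature.NumberTheory.Automorphic.CMPrincipalSeriesTraceOrbitalForm        -- ★ orbital torus form `smoothTrace_cmPrincipalSeries_map_symm_eq_inv_mul_integral` (Rogawski (4.9.4), canonical orbital integrals)
import Literature.MeasureTheory.Group.CharacterIntegralsTwoCosetInversion             -- ★ p849506 (this seat, Stage (A)): `eq_twoCoset_of_forall_integral_char_mul_eq_of_comm`
import Literature.NumberTheory.Automorphic.CMPrincipalSeriesJacquetEvalOne            -- ★ `nonarchimedeanGroup_cmLocal` (open subgroups form a basis at `1`)
import Literature.NumberTheory.Automorphic.JacquetNonzeroEmbedsNormalizedInd          -- ★ `torusU_mul_comm`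
import Literature.NumberTheory.Automorphic.CMTorusRegularAEPrelims                    -- ★ `isClosed_torusU_of_t1Space`
import Literature.NumberTheory.Automorphic.LocalUnitaryIntegralLevel                  -- ★ `isCompact_isOpen_cmLocalIntegralLevel`
import HarnessLib

/-!
# F0 · P3c · line LH6 «StCharTS» — road (D) «DEEP-FL», brick D3-ii «SHELL-ORBITAL-G»: the CANONICAL split-torus orbital integrals read off the orbital torus form of
# `tr i_G(χ)` and the all-level shell traces — `δ^{1∕2} J₃⁻¹ O^{can}(f)` IS the explicit two-coset step function (Rogawski 1990 (4.9.4) p. 56, §12.5 p. 183; Hewitt–Ross (23.11))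

Cell `pub/hodgecm-mathlib`, crux H413 = `stmt-HodgeConjecture-24833` (lane `--supports … --as helper`), route HCCMUnconditional; seat LH2-p03 (g3) (free hand released to F0P3b-plan
(g23), DEAL «D3-ii SHELL-ORBITAL (G)» 2026-09-02T05:17:01Z; road owner LH6-p04 (g2), specs `F0/P3b/LH6-p04/g2/ROAD-D.status.v3.txt` 3b2344d0ef34a5f7 § D3-ii +
`ROAD-D.interface.v2.txt` e7201338631be5de).  THEOREMS ONLY, sorry-free; no definition ∕ instance ∕ notation ∕ named fact; ★-only imports.  HONEST LABEL: HC_CM is proved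
only modulo the 7 printed citations (2 remaining: hLiu418 = stmt-HodgeConjecture-24832, h413 = stmt-HodgeConjecture-24833) until rung 0 closes; road-(D) brick, count-neutral,
closes nothing by itself (D3-iii∕iv and the (D-c) assembly remain the owner's).

THE MATHEMATICS.  `G′_v = U(H)(L⁺_v) ≅ U(Φ₃)(L⁺_v)` at a non-split place `v` (frame `e`, ★ `cmDatumLocalCongr`), `M` the diagonal torus, `μ_T` a Haar measure on `M`, `m_G` the
canonical orbital measures of the Haar measure `ν_G`.  ★ (4.9.4) (`CMPrincipalSeriesTraceOrbitalForm`): for every continuous character `χ` of `M`,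
`tr i_G(χ)(f ∘ e) = μ_T(M ∩ K_v)⁻¹ · ∫_M χ(t) Ψ_f(t) dμ_T` where `Ψ_f = δ_B^{1∕2} · J₃⁻¹ · O^{can}(f)` a.e. (`J₃(t) = |D(t)|`-type torus module).  If, for the test function `f`,
the left side is known in closed form for ALL `χ` — `= A · [χ|_C = 1] · (χ(b₁) + κ χ(b₂))` for a compact open `C ≤ M` and `b₁, b₂ ∈ M` (hypothesis `hF1`; for the shell
indicator `f = 𝟙_{K_n b K_n}` this is the all-level shell trace ★ `Theorems/F0P3cStCharTSShellTracePS.smoothTrace_cmPrincipalSeries_indicator_shell_eq_ite` with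
`C = M ∩ K_n`, `b₁ = b`, `b₂ = bʷ`, `A = ν(K_n)·#R·δ_B^{1∕2}(b)`, `κ = 1` in its `χ(b) + (wχ)(b)` reading — F1-G, LH10-p02 (g2)) — and if the a.e.-class `Ψ_f` has a locally constant
compactly supported representative `Ψ` (hypothesis `hΨ`; for the shell indicator: local constancy of regular orbital integrals along the torus ★
`RegularOrbitalIntegralLocallyConstantCM` + compact support by the shell valuations ★ D3-i `F0P3cStCharTSShellRoots` — the PRODUCER, next file), then two-coset Fourier
inversion on the abelian group `M` (★ Stage (A) `eq_twoCoset_of_forall_integral_char_mul_eq_of_comm`: `M` is commutative ★ `torusU_mul_comm`, its open subgroups form a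
basis at `1` ★ `nonarchimedeanGroup_cmLocal`, `0 < μ_T(M ∩ K_v) < ∞` ★ `isCompact_isOpen_cmLocalIntegralLevel` + ★ `isClosed_torusU_of_t1Space`) gives the POINTWISE identity
  **`Ψ = (A · μ_T(M ∩ K_v) ∕ μ_T(C)) · (𝟙_{b₁C} + κ · 𝟙_{b₂C})`** on all of `M`
— v2's «`O^{can}_t(𝟙_{K_nbK_n}) = J(t)·δ^{-1∕2}(t)·κ_G·(𝟙_{b(M∩K_n)}(t) + δ(b)𝟙_{bʷ(M∩K_n)}(t))`» with **`κ_G = A·μ_T(M ∩ K_v)∕μ_T(M ∩ K_n)`** explicit, read at every regular `t`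
where `Ψ(t) = δ^{1∕2}(t)J₃(t)⁻¹O^{can}_t` (the producer's pointwise clause).  The H twin (`U(Φ₂) × U(Φ₁)`, LH7-p04 (g2)) uses the same Stage (A).

* `exists_isOpen_subgroup_subset_cmBorelM` — `hbasis` for `M` (open subgroups of the torus form a neighbourhood basis at `1`);
* `measureReal_cmBorelM_inter_level_pos` — `0 < μ_T{t ∈ M ∣ t ∈ K_v}`;
* **`normalizedOrbitalIntegral_eq_twoCoset`** — the head (binder block of ★ `smoothTrace_cmPrincipalSeries_map_symm_eq_inv_mul_integral` VERBATIM, `χ`∕`Φ` replaced by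
  the shell data `C b₁ b₂ A κ`, `hF1`, and `Ψ hΨlc hΨK hΨ`).

## References
* [Rogawski1990] J. D. Rogawski, *Automorphic Representations of Unitary Groups in Three Variables*, Ann. of Math. Stud. 123 (1990): §4.9 Lemma 4.9.2, (4.9.4) p. 56; §12.5
  p. 183 (orbital integrals of Iwahori–Hecke functions on the split torus).
* [HewittRoss1979] E. Hewitt, K. A. Ross, *Abstract Harmonic Analysis I* (1979), Thm. (23.11) (Fourier uniqueness).
* [vanDijk1972] G. van Dijk, *Computation of certain induced characters of p-adic groups*, Math. Ann. 199 (1972), Thm. p. 237.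
-/

set_option autoImplicit false
set_option linter.dupNamespace false

noncomputable section

open NumberField IsDedekindDomain MeasureTheory MeasureTheory.Measure Topology Filter Set
open scoped Matrix MatrixGroups NNReal ENNReal Classical
open Literature.MeasureTheory.Group Literature.NumberTheory.Automorphic Literature.NumberTheory.Automorphic.UnitaryGroup
open Literature.NumberTheory.Rogawski1990 (IsRegularElt)

namespace Summit.HodgeConjecture.HodgeConjecture.Cruxes.H413.F0P3cStCharTSShellOrbitalG

variable (L : Type) [Field L] [NumberField L] [IsCMField L]

/-! ## §1 The torus `M`: a basis of open subgroups, and the mass of `M ∩ K_v` -/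

/-- **Open subgroups of the diagonal torus `M ≤ U(Φ₃)(L⁺_v)` form a neighbourhood basis at `1`** (`U(Φ₃)(L⁺_v)` is non-archimedean, ★ `nonarchimedeanGroup_cmLocal`;
trace an open subgroup on `M`) — the `hbasis` binder of ★ `eq_twoCoset_of_forall_integral_char_mul_eq_of_comm`. [cite: Rogawski1990, §12.5 p. 183] -/
theorem exists_isOpen_subgroup_subset_cmBorelM (v : HeightOneSpectrum (𝓞 ↥(maximalRealSubfield L)))
    (V : Set ↥(cmBorelTriple L 3 v).M) (hV : V ∈ 𝓝 (1 : ↥(cmBorelTriple L 3 v).M)) :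
    ∃ C' : Subgroup ↥(cmBorelTriple L 3 v).M, IsOpen (C' : Set ↥(cmBorelTriple L 3 v).M) ∧ (C' : Set ↥(cmBorelTriple L 3 v).M) ⊆ V := by
  haveI := nonarchimedeanGroup_cmLocal L 3 v
  obtain ⟨U, hU, hUV⟩ := (mem_nhds_subtype _ (1 : ↥(cmBorelTriple L 3 v).M) V).1 hV
  obtain ⟨W, hW⟩ := NonarchimedeanGroup.is_nonarchimedean U (by simpa using hU)
  refine ⟨(W : Subgroup ↥(unitaryGroupOfForm (conjLocal L (IsCMField.complexConj L) v) (cmLocalForm L 3 v))).comap (cmBorelTriple L 3 v).M.subtype, ?_, fun x hx => hUV (hW hx)⟩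
  exact W.isOpen.preimage continuous_subtype_val

/-- **`0 < μ_T{t ∈ M ∣ t ∈ K_v} < ∞`** for a Haar measure `μ_T` on the torus: `K_v` is compact open (★ `isCompact_isOpen_cmLocalIntegralLevel`), `M` is closed (★
`isClosed_torusU_of_t1Space`). [cite: Rogawski1990, §4.9 (4.9.4) p. 56] -/
theorem measureReal_cmBorelM_inter_level_pos (v : HeightOneSpectrum (𝓞 ↥(maximalRealSubfield L)))
    [MeasurableSpace ↥(unitaryGroupOfForm (conjLocal L (IsCMField.complexConj L) v) (cmLocalForm L 3 v))] [BorelSpace ↥(unitaryGroupOfForm (conjLocal L (IsCMField.complexConj L) v) (cmLocalForm L 3 v))]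
    (μT : Measure ↥(cmBorelTriple L 3 v).M) [μT.IsHaarMeasure] :
    0 < μT.real {t : ↥(cmBorelTriple L 3 v).M |
          (t : ↥(unitaryGroupOfForm (conjLocal L (IsCMField.complexConj L) v) (cmLocalForm L 3 v))) ∈
            cmLocalIntegralLevel L 3 (Matrix.of fun i j : Fin 3 => if i.val + j.val + 1 = 3 then (1 : L) else 0) v} := by
  haveI := locallyCompactSpace_cmBorelU L 3 v
  haveI : T1Space (LocalRing L v) := inferInstance
  have hKco := isCompact_isOpen_cmLocalIntegralLevel L 3 (Matrix.of fun i j : Fin 3 => if i.val + j.val + 1 = 3 then (1 : L) else 0) v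
  have hTcl := isClosed_torusU_of_t1Space (conjLocal L (IsCMField.complexConj L) v) (cmLocalForm L 3 v)
  have hop : IsOpen {t : ↥(cmBorelTriple L 3 v).M |
          (t : ↥(unitaryGroupOfForm (conjLocal L (IsCMField.complexConj L) v) (cmLocalForm L 3 v))) ∈
            cmLocalIntegralLevel L 3 (Matrix.of fun i j : Fin 3 => if i.val + j.val + 1 = 3 then (1 : L) else 0) v} := hKco.2.preimage continuous_subtype_val
  have hcp : IsCompact {t : ↥(cmBorelTriple L 3 v).M |
          (t : ↥(unitaryGroupOfForm (conjLocal L (IsCMField.complexConj L) v) (cmLocalForm L 3 v))) ∈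
            cmLocalIntegralLevel L 3 (Matrix.of fun i j : Fin 3 => if i.val + j.val + 1 = 3 then (1 : L) else 0) v} := hTcl.isClosedEmbedding_subtypeVal.isCompact_preimage hKco.1
  have h0 : μT {t : ↥(cmBorelTriple L 3 v).M |
          (t : ↥(unitaryGroupOfForm (conjLocal L (IsCMField.complexConj L) v) (cmLocalForm L 3 v))) ∈
            cmLocalIntegralLevel L 3 (Matrix.of fun i j : Fin 3 => if i.val + j.val + 1 = 3 then (1 : L) else 0) v} ≠ 0 := hop.measure_ne_zero μT ⟨1, by
    show ((1 : ↥(cmBorelTriple L 3 v).M) : ↥(unitaryGroupOfForm (conjLocal L (IsCMField.complexConj L) v) (cmLocalForm L 3 v))) ∈ cmLocalIntegralLevel L 3 (Matrix.of fun i j : Fin 3 => if i.val + j.val + 1 = 3 then (1 : L) else 0) v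
    rw [OneMemClass.coe_one]; exact Subgroup.one_mem _⟩
  exact ENNReal.toReal_pos h0 hcp.measure_lt_top.ne

/-! ## §2 The head: `δ^{1∕2} J₃⁻¹ O^{can}(f)` is the two-coset step function -/

set_option maxHeartbeats 1600000 in
set_option synthInstance.maxHeartbeats 400000 in
/-- **D3-ii «SHELL-ORBITAL-G» — THE CANONICAL SPLIT-TORUS ORBITAL INTEGRALS FROM THE SHELL TRACES.**  Binders of ★ `smoothTrace_cmPrincipalSeries_map_symm_eq_inv_mul_integral`
verbatim (inner form `U(H)(L⁺_v)`, frame `e = cmDatumLocalCongr L v T ha h`, Haar `ν_G`, canonical family `m_G`, Haar `μ_T` on the torus `M`, locally constant compactly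
supported `f`), shell data `C ≤ M` compact open, `b₁ b₂ ∈ M`, `A κ ∈ ℂ`, and two hypotheses: `hF1` — the trace of `i_G(χ)` on `f ∘ e` is `A·[χ|_C = 1]·(χ(b₁) + κχ(b₂))` for EVERY
continuous character `χ` of `M` (for `f = 𝟙_{K_nbK_n}`: ★ `F0P3cStCharTSShellTracePS.smoothTrace_cmPrincipalSeries_indicator_shell_eq_ite`); `hΨ` — `Ψ : M → ℂ` locally constant
with compact support, a.e. equal to `δ_B^{1∕2}(t) · J₃(t)⁻¹ · classOrbitalIntegral m_G f ⟦e t⟧` (the ★ `Φ`-clause WITHOUT the character).  THEN, everywhere on `M`,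
`Ψ = (A · μ_T{t ∈ K_v} ∕ μ_T(C)) · (𝟙_{b₁C} + κ 𝟙_{b₂C})`.  (★ (4.9.4) with `Φ := χ·Ψ`; `hF1`; `0 < μ_T{t ∈ K_v}`; ★ two-coset inversion on the commutative (★ `torusU_mul_comm`)
non-archimedean torus.) [cite: Rogawski1990, §4.9 Lemma 4.9.2, (4.9.4) p. 56; §12.5 p. 183] [cite: HewittRoss1979, Thm. (23.11)] [cite: vanDijk1972, Thm. p. 237] -/
theorem normalizedOrbitalIntegral_eq_twoCoset
    (H : Matrix (Fin 3) (Fin 3) L) (hH : (H.map (IsCMField.complexConj L))ᵀ = H) (hHd : IsUnit H.det)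
    {v : HeightOneSpectrum (𝓞 ↥(maximalRealSubfield L))} (w : PlacesOver L v) (hw : IsCMField.complexConj L • w.1 = w.1)
    (T : GL (Fin 3) (LocalRing L v)) {a : LocalRing L v} (ha : IsUnit a)
    (h : formCongr (conjLocal L (IsCMField.complexConj L) v) T (H.map (algebraMap L (LocalRing L v))) =
      a • (Matrix.of fun i j : Fin 3 => if i.val + j.val + 1 = 3 then (1 : L) else 0).map (algebraMap L (LocalRing L v)))
    [MeasurableSpace ((cmDatum L 3 H).Local v)] [BorelSpace ((cmDatum L 3 H).Local v)]
    [∀ γ : (cmDatum L 3 H).Local v, MeasurableSpace (((cmDatum L 3 H).Local v) ⧸ Subgroup.centralizer ({γ} : Set ((cmDatum L 3 H).Local v)))]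
    [∀ γ : (cmDatum L 3 H).Local v, BorelSpace (((cmDatum L 3 H).Local v) ⧸ Subgroup.centralizer ({γ} : Set ((cmDatum L 3 H).Local v)))]
    (νG : Measure ((cmDatum L 3 H).Local v)) [νG.IsHaarMeasure] [νG.IsMulRightInvariant]
    {mG : OrbitalMeasureFamily ((cmDatum L 3 H).Local v)}
    (hmG : mG.IsCanonical (fun γ => IsRegularElt (γ.val : GL (Fin 3) (LocalRing L v))) νG)
    [MeasurableSpace ↥(unitaryGroupOfForm (conjLocal L (IsCMField.complexConj L) v) (cmLocalForm L 3 v))]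
    [BorelSpace ↥(unitaryGroupOfForm (conjLocal L (IsCMField.complexConj L) v) (cmLocalForm L 3 v))]
    (μT : Measure ↥(cmBorelTriple L 3 v).M) [μT.IsHaarMeasure]
    (f : (cmDatum L 3 H).Local v → ℂ) (hf : IsLocallyConstant f) (hfc : HasCompactSupport f)
    (C : Subgroup ↥(cmBorelTriple L 3 v).M) (hCo : IsOpen (C : Set ↥(cmBorelTriple L 3 v).M)) (hCc : IsCompact (C : Set ↥(cmBorelTriple L 3 v).M))
    (b₁ b₂ : ↥(cmBorelTriple L 3 v).M) (A κ : ℂ)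
    (hF1 : ∀ (χ : ↥(torusU (conjLocal L (IsCMField.complexConj L) v) (cmLocalForm L 3 v)) →* ℂˣ) (hχ : Continuous fun t => ((χ t : ℂˣ) : ℂ)),
      (cmPrincipalSeries L 3 v χ).smoothTrace (νG.map (cmDatumLocalCongr L v T ha h).symm)
        (fun x : ↥(unitaryGroupOfForm (conjLocal L (IsCMField.complexConj L) v) (cmLocalForm L 3 v)) => f (cmDatumLocalCongr L v T ha h x)) =
        if (∀ c ∈ C, χ c = 1) then A * (((χ b₁ : ℂˣ) : ℂ) + κ * ((χ b₂ : ℂˣ) : ℂ)) else 0)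
    (Ψ : ↥(cmBorelTriple L 3 v).M → ℂ) (hΨlc : IsLocallyConstant Ψ) (hΨK : HasCompactSupport Ψ)
    (hΨ : haveI := locallyCompactSpace_cmBorelU L 3 v
      ∀ᵐ (t : ↥(cmBorelTriple L 3 v).M) ∂μT, ∀ (d : Fin 3 → (LocalRing L v)ˣ)
      (hd : glDiagonal 3 (LocalRing L v) d =
        ((t : ↥(unitaryGroupOfForm (conjLocal L (IsCMField.complexConj L) v) (cmLocalForm L 3 v))) : GL (Fin 3) (LocalRing L v)))
      (ha' : IsUnit ((((d 0)⁻¹ * d 1 : (LocalRing L v)ˣ) : LocalRing L v) - 1))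
      (hb' : IsUnit ((((d 0)⁻¹ * d 2 : (LocalRing L v)ˣ) : LocalRing L v) - 1)),
      Ψ t =
          ((rootDeltaChar (cmBorelTriple L 3 v).P
            ⟨(t : ↥(unitaryGroupOfForm (conjLocal L (IsCMField.complexConj L) v) (cmLocalForm L 3 v))), (cmBorelTriple L 3 v).M_le t.2⟩ : ℂˣ) : ℂ) *
        (((letI : MeasurableSpace (LocalRing L v) := borel _; haveI : BorelSpace (LocalRing L v) := ⟨rfl⟩
          haveI : SecondCountableTopology (LocalRing L v) := secondCountableTopology_localRing (E := L) v
          ((distribHaarChar (LocalRing L v) ha'.unit)⁻¹ *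
            (HeisRing.skewModulus (conjLocal L (IsCMField.complexConj L) v) (continuous_conjLocal L (IsCMField.complexConj L) v) hb'.unit
              (HeisRing.map_unit_torusCentralScalar_sub_one (conjLocal L (IsCMField.complexConj L) v) (cmLocalForm_eq_over L 3 v) t hd hb'))⁻¹ :
                ℝ≥0)) : ℝ) : ℂ)⁻¹ *
        classOrbitalIntegral mG f
          (ConjClasses.mk (cmDatumLocalCongr L v T ha h (t : ↥(unitaryGroupOfForm (conjLocal L (IsCMField.complexConj L) v) (cmLocalForm L 3 v)))))) :
    Ψ = fun t => (A * ((μT.real {t : ↥(cmBorelTriple L 3 v).M |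
          (t : ↥(unitaryGroupOfForm (conjLocal L (IsCMField.complexConj L) v) (cmLocalForm L 3 v))) ∈
            cmLocalIntegralLevel L 3 (Matrix.of fun i j : Fin 3 => if i.val + j.val + 1 = 3 then (1 : L) else 0) v} : ℝ) : ℂ)) / ((μT.real (C : Set ↥(cmBorelTriple L 3 v).M) : ℝ) : ℂ) *
      ({t : ↥(cmBorelTriple L 3 v).M | b₁⁻¹ * t ∈ (C : Set ↥(cmBorelTriple L 3 v).M)}.indicator (fun _ => (1 : ℂ)) t + κ * {t : ↥(cmBorelTriple L 3 v).M | b₂⁻¹ * t ∈ (C : Set ↥(cmBorelTriple L 3 v).M)}.indicator (fun _ => (1 : ℂ)) t) := by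
  haveI := locallyCompactSpace_cmBorelU L 3 v
  -- the torus mass `c = μ_T{t ∈ K_v} > 0`
  have hcpos := measureReal_cmBorelM_inter_level_pos L v μT
  set c : ℝ := μT.real {t : ↥(cmBorelTriple L 3 v).M |
          (t : ↥(unitaryGroupOfForm (conjLocal L (IsCMField.complexConj L) v) (cmLocalForm L 3 v))) ∈
            cmLocalIntegralLevel L 3 (Matrix.of fun i j : Fin 3 => if i.val + j.val + 1 = 3 then (1 : L) else 0) v} with hcdef
  have hc0 : (c : ℂ) ≠ 0 := by exact_mod_cast hcpos.ne'
  -- (4.9.4) with `Φ := χ · Ψ`, then `hF1`: the character integrals of `Ψ`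
  have key : ∀ χ : ↥(torusU (conjLocal L (IsCMField.complexConj L) v) (cmLocalForm L 3 v)) →* ℂˣ, Continuous (fun t => ((χ t : ℂˣ) : ℂ)) →
      ∫ t, ((χ t : ℂˣ) : ℂ) * Ψ t ∂μT = if (∀ c ∈ C, χ c = 1) then (A * (c : ℂ)) * (((χ b₁ : ℂˣ) : ℂ) + κ * ((χ b₂ : ℂˣ) : ℂ)) else 0 := by
    intro χ hχ
    have horb := smoothTrace_cmPrincipalSeries_map_symm_eq_inv_mul_integral L H hH hHd w hw T ha h νG hmG χ hχ μT f hf hfc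
      (fun t => ((χ t : ℂˣ) : ℂ) * Ψ t) (by
        filter_upwards [hΨ] with t ht d hd ha' hb'
        rw [ht d hd ha' hb']
        ring)
    rw [hF1 χ hχ] at horb
    -- `horb : (if … then … else 0) = c⁻¹ * ∫ χΨ`
    have hsolve : ∫ t, ((χ t : ℂˣ) : ℂ) * Ψ t ∂μT = (c : ℂ) * (if (∀ c ∈ C, χ c = 1) then A * (((χ b₁ : ℂˣ) : ℂ) + κ * ((χ b₂ : ℂˣ) : ℂ)) else 0) := by
      rw [horb, ← hcdef, ← mul_assoc, Complex.ofReal_inv, mul_inv_cancel₀ hc0, one_mul]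
    rw [hsolve]
    by_cases h1 : ∀ c ∈ C, χ c = 1
    · simp only [if_pos h1]; ring
    · simp only [if_neg h1, mul_zero]
  -- two-coset Fourier inversion on the torus
  have hinv := eq_twoCoset_of_forall_integral_char_mul_eq_of_comm μT (fun x y : ↥(cmBorelTriple L 3 v).M => torusU_mul_comm _ _ x y) C hCo hCc
    (exists_isOpen_subgroup_subset_cmBorelM L v) hΨlc hΨK b₁ b₂ (A * (c : ℂ)) κ
    (fun χ hχc _ _ => key χ hχc)
  rw [hinv]


set_option maxHeartbeats 1600000 in
set_option synthInstance.maxHeartbeats 400000 in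
/-- **THE CLOSED FORM OF THE CANONICAL ORBITAL INTEGRAL AT A TORUS POINT** (the consumer shape of D3-iv-c: ★ `classOrbitalIntegral mG f (ConjClasses.mk (e t))`, LH6-p04 (g2)
05:25:47Z): under the hypotheses of `normalizedOrbitalIntegral_eq_twoCoset`, at every `t ∈ M` with a diagonal writing `d` off the walls (`d₀⁻¹d₁ − 1`, `d₀⁻¹d₂ − 1` units)
where `Ψ(t)` IS the normalised orbital integral (the pointwise form of `hΨ` — e.g. every regular `t` once `Ψ` is produced by local constancy),
`O^{can}_{e t}(f) = J₃(t) · δ_B^{1∕2}(t)⁻¹ · κ_G · (𝟙_{b₁C}(t) + κ 𝟙_{b₂C}(t))`, `κ_G = A·μ_T{t ∈ K_v}∕μ_T(C)`, `J₃(t) = (χ_R(d₀⁻¹d₁) · χ⁻(d₀⁻¹d₂))⁻¹` the torus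
module of ★ (4.9.4) (non-zero: ★ `distribHaarChar_pos`, ★ `HeisRing.skewModulus_pos`). [cite: Rogawski1990, §4.9 (4.9.4) p. 56; §12.5 p. 183] [cite: vanDijk1972, Thm. p. 237] -/
theorem classOrbitalIntegral_mk_eq_twoCoset
    (H : Matrix (Fin 3) (Fin 3) L) (hH : (H.map (IsCMField.complexConj L))ᵀ = H) (hHd : IsUnit H.det)
    {v : HeightOneSpectrum (𝓞 ↥(maximalRealSubfield L))} (w : PlacesOver L v) (hw : IsCMField.complexConj L • w.1 = w.1)
    (T : GL (Fin 3) (LocalRing L v)) {a : LocalRing L v} (ha : IsUnit a)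
    (h : formCongr (conjLocal L (IsCMField.complexConj L) v) T (H.map (algebraMap L (LocalRing L v))) =
      a • (Matrix.of fun i j : Fin 3 => if i.val + j.val + 1 = 3 then (1 : L) else 0).map (algebraMap L (LocalRing L v)))
    [MeasurableSpace ((cmDatum L 3 H).Local v)] [BorelSpace ((cmDatum L 3 H).Local v)]
    [∀ γ : (cmDatum L 3 H).Local v, MeasurableSpace (((cmDatum L 3 H).Local v) ⧸ Subgroup.centralizer ({γ} : Set ((cmDatum L 3 H).Local v)))]
    [∀ γ : (cmDatum L 3 H).Local v, BorelSpace (((cmDatum L 3 H).Local v) ⧸ Subgroup.centralizer ({γ} : Set ((cmDatum L 3 H).Local v)))]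
    (νG : Measure ((cmDatum L 3 H).Local v)) [νG.IsHaarMeasure] [νG.IsMulRightInvariant]
    {mG : OrbitalMeasureFamily ((cmDatum L 3 H).Local v)}
    (hmG : mG.IsCanonical (fun γ => IsRegularElt (γ.val : GL (Fin 3) (LocalRing L v))) νG)
    [MeasurableSpace ↥(unitaryGroupOfForm (conjLocal L (IsCMField.complexConj L) v) (cmLocalForm L 3 v))]
    [BorelSpace ↥(unitaryGroupOfForm (conjLocal L (IsCMField.complexConj L) v) (cmLocalForm L 3 v))]
    (μT : Measure ↥(cmBorelTriple L 3 v).M) [μT.IsHaarMeasure]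
    (f : (cmDatum L 3 H).Local v → ℂ) (hf : IsLocallyConstant f) (hfc : HasCompactSupport f)
    (C : Subgroup ↥(cmBorelTriple L 3 v).M) (hCo : IsOpen (C : Set ↥(cmBorelTriple L 3 v).M)) (hCc : IsCompact (C : Set ↥(cmBorelTriple L 3 v).M))
    (b₁ b₂ : ↥(cmBorelTriple L 3 v).M) (A κ : ℂ)
    (hF1 : ∀ (χ : ↥(torusU (conjLocal L (IsCMField.complexConj L) v) (cmLocalForm L 3 v)) →* ℂˣ) (hχ : Continuous fun t => ((χ t : ℂˣ) : ℂ)),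
      (cmPrincipalSeries L 3 v χ).smoothTrace (νG.map (cmDatumLocalCongr L v T ha h).symm)
        (fun x : ↥(unitaryGroupOfForm (conjLocal L (IsCMField.complexConj L) v) (cmLocalForm L 3 v)) => f (cmDatumLocalCongr L v T ha h x)) =
        if (∀ c ∈ C, χ c = 1) then A * (((χ b₁ : ℂˣ) : ℂ) + κ * ((χ b₂ : ℂˣ) : ℂ)) else 0)
    (Ψ : ↥(cmBorelTriple L 3 v).M → ℂ) (hΨlc : IsLocallyConstant Ψ) (hΨK : HasCompactSupport Ψ)
    (hΨ : haveI := locallyCompactSpace_cmBorelU L 3 v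
      ∀ᵐ (t : ↥(cmBorelTriple L 3 v).M) ∂μT, ∀ (d : Fin 3 → (LocalRing L v)ˣ)
      (hd : glDiagonal 3 (LocalRing L v) d =
        ((t : ↥(unitaryGroupOfForm (conjLocal L (IsCMField.complexConj L) v) (cmLocalForm L 3 v))) : GL (Fin 3) (LocalRing L v)))
      (ha' : IsUnit ((((d 0)⁻¹ * d 1 : (LocalRing L v)ˣ) : LocalRing L v) - 1))
      (hb' : IsUnit ((((d 0)⁻¹ * d 2 : (LocalRing L v)ˣ) : LocalRing L v) - 1)),
      Ψ t =
          ((rootDeltaChar (cmBorelTriple L 3 v).P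
            ⟨(t : ↥(unitaryGroupOfForm (conjLocal L (IsCMField.complexConj L) v) (cmLocalForm L 3 v))), (cmBorelTriple L 3 v).M_le t.2⟩ : ℂˣ) : ℂ) *
        (((letI : MeasurableSpace (LocalRing L v) := borel _; haveI : BorelSpace (LocalRing L v) := ⟨rfl⟩
          haveI : SecondCountableTopology (LocalRing L v) := secondCountableTopology_localRing (E := L) v
          ((distribHaarChar (LocalRing L v) ha'.unit)⁻¹ *
            (HeisRing.skewModulus (conjLocal L (IsCMField.complexConj L) v) (continuous_conjLocal L (IsCMField.complexConj L) v) hb'.unit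
              (HeisRing.map_unit_torusCentralScalar_sub_one (conjLocal L (IsCMField.complexConj L) v) (cmLocalForm_eq_over L 3 v) t hd hb'))⁻¹ :
                ℝ≥0)) : ℝ) : ℂ)⁻¹ *
        classOrbitalIntegral mG f
          (ConjClasses.mk (cmDatumLocalCongr L v T ha h (t : ↥(unitaryGroupOfForm (conjLocal L (IsCMField.complexConj L) v) (cmLocalForm L 3 v))))))
    (t : ↥(cmBorelTriple L 3 v).M) (d : Fin 3 → (LocalRing L v)ˣ)
    (hd : glDiagonal 3 (LocalRing L v) d =
        ((t : ↥(unitaryGroupOfForm (conjLocal L (IsCMField.complexConj L) v) (cmLocalForm L 3 v))) : GL (Fin 3) (LocalRing L v)))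
    (ha' : IsUnit ((((d 0)⁻¹ * d 1 : (LocalRing L v)ˣ) : LocalRing L v) - 1))
    (hb' : IsUnit ((((d 0)⁻¹ * d 2 : (LocalRing L v)ˣ) : LocalRing L v) - 1))
    (hpt : haveI := locallyCompactSpace_cmBorelU L 3 v
      Ψ t = ((rootDeltaChar (cmBorelTriple L 3 v).P
            ⟨(t : ↥(unitaryGroupOfForm (conjLocal L (IsCMField.complexConj L) v) (cmLocalForm L 3 v))), (cmBorelTriple L 3 v).M_le t.2⟩ : ℂˣ) : ℂ) *
        (((letI : MeasurableSpace (LocalRing L v) := borel _; haveI : BorelSpace (LocalRing L v) := ⟨rfl⟩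
          haveI : SecondCountableTopology (LocalRing L v) := secondCountableTopology_localRing (E := L) v
          ((distribHaarChar (LocalRing L v) ha'.unit)⁻¹ *
            (HeisRing.skewModulus (conjLocal L (IsCMField.complexConj L) v) (continuous_conjLocal L (IsCMField.complexConj L) v) hb'.unit
              (HeisRing.map_unit_torusCentralScalar_sub_one (conjLocal L (IsCMField.complexConj L) v) (cmLocalForm_eq_over L 3 v) t hd hb'))⁻¹ :
                ℝ≥0)) : ℝ) : ℂ)⁻¹ *
        classOrbitalIntegral mG f
          (ConjClasses.mk (cmDatumLocalCongr L v T ha h (t : ↥(unitaryGroupOfForm (conjLocal L (IsCMField.complexConj L) v) (cmLocalForm L 3 v)))))) :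
    haveI := locallyCompactSpace_cmBorelU L 3 v
    classOrbitalIntegral mG f
          (ConjClasses.mk (cmDatumLocalCongr L v T ha h (t : ↥(unitaryGroupOfForm (conjLocal L (IsCMField.complexConj L) v) (cmLocalForm L 3 v))))) =
      (((letI : MeasurableSpace (LocalRing L v) := borel _; haveI : BorelSpace (LocalRing L v) := ⟨rfl⟩
          haveI : SecondCountableTopology (LocalRing L v) := secondCountableTopology_localRing (E := L) v
          ((distribHaarChar (LocalRing L v) ha'.unit)⁻¹ *
            (HeisRing.skewModulus (conjLocal L (IsCMField.complexConj L) v) (continuous_conjLocal L (IsCMField.complexConj L) v) hb'.unit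
              (HeisRing.map_unit_torusCentralScalar_sub_one (conjLocal L (IsCMField.complexConj L) v) (cmLocalForm_eq_over L 3 v) t hd hb'))⁻¹ :
                ℝ≥0)) : ℝ) : ℂ) *
        ((rootDeltaChar (cmBorelTriple L 3 v).P
            ⟨(t : ↥(unitaryGroupOfForm (conjLocal L (IsCMField.complexConj L) v) (cmLocalForm L 3 v))), (cmBorelTriple L 3 v).M_le t.2⟩ : ℂˣ) : ℂ)⁻¹ *
        ((A * ((μT.real {t : ↥(cmBorelTriple L 3 v).M |
          (t : ↥(unitaryGroupOfForm (conjLocal L (IsCMField.complexConj L) v) (cmLocalForm L 3 v))) ∈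
            cmLocalIntegralLevel L 3 (Matrix.of fun i j : Fin 3 => if i.val + j.val + 1 = 3 then (1 : L) else 0) v} : ℝ) : ℂ)) / ((μT.real (C : Set ↥(cmBorelTriple L 3 v).M) : ℝ) : ℂ) * ({t : ↥(cmBorelTriple L 3 v).M | b₁⁻¹ * t ∈ (C : Set ↥(cmBorelTriple L 3 v).M)}.indicator (fun _ => (1 : ℂ)) t + κ * {t : ↥(cmBorelTriple L 3 v).M | b₂⁻¹ * t ∈ (C : Set ↥(cmBorelTriple L 3 v).M)}.indicator (fun _ => (1 : ℂ)) t)) := by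
  haveI := locallyCompactSpace_cmBorelU L 3 v
  have hmain := normalizedOrbitalIntegral_eq_twoCoset L H hH hHd w hw T ha h νG hmG μT f hf hfc C hCo hCc b₁ b₂ A κ hF1 Ψ hΨlc hΨK hΨ
  have hΨt := congrFun hmain t
  dsimp only at hΨt
  rw [hpt] at hΨt
  have hDEL : ((rootDeltaChar (cmBorelTriple L 3 v).P
            ⟨(t : ↥(unitaryGroupOfForm (conjLocal L (IsCMField.complexConj L) v) (cmLocalForm L 3 v))), (cmBorelTriple L 3 v).M_le t.2⟩ : ℂˣ) : ℂ) ≠ 0 :=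
    (rootDeltaChar (cmBorelTriple L 3 v).P ⟨(t : ↥(unitaryGroupOfForm (conjLocal L (IsCMField.complexConj L) v) (cmLocalForm L 3 v))), (cmBorelTriple L 3 v).M_le t.2⟩).ne_zero
  have hJJ : (((letI : MeasurableSpace (LocalRing L v) := borel _; haveI : BorelSpace (LocalRing L v) := ⟨rfl⟩
          haveI : SecondCountableTopology (LocalRing L v) := secondCountableTopology_localRing (E := L) v
          ((distribHaarChar (LocalRing L v) ha'.unit)⁻¹ *
            (HeisRing.skewModulus (conjLocal L (IsCMField.complexConj L) v) (continuous_conjLocal L (IsCMField.complexConj L) v) hb'.unit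
              (HeisRing.map_unit_torusCentralScalar_sub_one (conjLocal L (IsCMField.complexConj L) v) (cmLocalForm_eq_over L 3 v) t hd hb'))⁻¹ :
                ℝ≥0)) : ℝ) : ℂ) ≠ 0 := by
    letI : MeasurableSpace (LocalRing L v) := borel _
    haveI : BorelSpace (LocalRing L v) := ⟨rfl⟩
    haveI : SecondCountableTopology (LocalRing L v) := secondCountableTopology_localRing (E := L) v
    exact Complex.ofReal_ne_zero.2 (NNReal.coe_ne_zero.2
      (mul_ne_zero (inv_ne_zero distribHaarChar_pos.ne') (inv_ne_zero (HeisRing.skewModulus_pos _ _ _ _).ne')))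
  have key : ∀ (D J O : ℂ), D ≠ 0 → J ≠ 0 → O = D⁻¹ * J * (D * J⁻¹ * O) := by
    intro D J O hD hJ
    field_simp
  calc classOrbitalIntegral mG f
          (ConjClasses.mk (cmDatumLocalCongr L v T ha h (t : ↥(unitaryGroupOfForm (conjLocal L (IsCMField.complexConj L) v) (cmLocalForm L 3 v)))))
      = (((rootDeltaChar (cmBorelTriple L 3 v).P
            ⟨(t : ↥(unitaryGroupOfForm (conjLocal L (IsCMField.complexConj L) v) (cmLocalForm L 3 v))), (cmBorelTriple L 3 v).M_le t.2⟩ : ℂˣ) : ℂ))⁻¹ * (((letI : MeasurableSpace (LocalRing L v) := borel _; haveI : BorelSpace (LocalRing L v) := ⟨rfl⟩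
          haveI : SecondCountableTopology (LocalRing L v) := secondCountableTopology_localRing (E := L) v
          ((distribHaarChar (LocalRing L v) ha'.unit)⁻¹ *
            (HeisRing.skewModulus (conjLocal L (IsCMField.complexConj L) v) (continuous_conjLocal L (IsCMField.complexConj L) v) hb'.unit
              (HeisRing.map_unit_torusCentralScalar_sub_one (conjLocal L (IsCMField.complexConj L) v) (cmLocalForm_eq_over L 3 v) t hd hb'))⁻¹ :
                ℝ≥0)) : ℝ) : ℂ) * (((rootDeltaChar (cmBorelTriple L 3 v).P
            ⟨(t : ↥(unitaryGroupOfForm (conjLocal L (IsCMField.complexConj L) v) (cmLocalForm L 3 v))), (cmBorelTriple L 3 v).M_le t.2⟩ : ℂˣ) : ℂ) * ((((letI : MeasurableSpace (LocalRing L v) := borel _; haveI : BorelSpace (LocalRing L v) := ⟨rfl⟩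
          haveI : SecondCountableTopology (LocalRing L v) := secondCountableTopology_localRing (E := L) v
          ((distribHaarChar (LocalRing L v) ha'.unit)⁻¹ *
            (HeisRing.skewModulus (conjLocal L (IsCMField.complexConj L) v) (continuous_conjLocal L (IsCMField.complexConj L) v) hb'.unit
              (HeisRing.map_unit_torusCentralScalar_sub_one (conjLocal L (IsCMField.complexConj L) v) (cmLocalForm_eq_over L 3 v) t hd hb'))⁻¹ :
                ℝ≥0)) : ℝ) : ℂ))⁻¹ * classOrbitalIntegral mG f
          (ConjClasses.mk (cmDatumLocalCongr L v T ha h (t : ↥(unitaryGroupOfForm (conjLocal L (IsCMField.complexConj L) v) (cmLocalForm L 3 v)))))) := key _ _ _ hDEL hJJ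
    _ = _ := by rw [hΨt]; ring

end Summit.HodgeConjecture.HodgeConjecture.Cruxes.H413.F0P3cStCharTSShellOrbitalG

end
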